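import Mathlib
import HarnessLib
import Summits.Ventures.LatticeQCDFlow.Scaling.LatticeEntropySUNLaw
import Summits.Ventures.LatticeQCDFlow.Scaling.EntropyBudgetHaarMoves
import Summits.Ventures.LatticeQCDFlow.Scaling.EntropyBudgetSUN

/-!
# LatticeQCDFlow / Scaling — the `SU(N)` volume × coupling laws, UNCONDITIONAL (v2.5)

HONEST FRAMING: exact (Metropolis-corrected) sampling algorithms for lattice gauge theory; figures
of merit are autocorrelation/cost numbers at stated couplings and volumes; no continuum-physics
claim.

(v2, landing row 30: the four corollaries `SUN.essM_volume_law`, `SUN.essM_flow_volume_law`,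
`SUN.essM_layers_volume_law`, `SUN.depth_lower_bound` live in `Scaling/EntropyBudgetSUN.lean` (row 30, same names and
statements); this file keeps theory2's two architecture-form corollaries.)

Venture `LatticeQCDFlow` (cell pub-lqcd), topic `Scaling`, FANOUT row 29 (theory2) — OUR WORK
(THEORY-2.md v2.5 §3.2 (h) / §4 rows T2-AG(m), T2-AI(m)).  One-line corollaries, nothing cited.

The landing seat (row 30, lean-1) proved `Lattice.SUN.entropyGrowthLaw d N : SUN.EntropyGrowthLaw
d N` for EVERY `N` (`Scaling/LatticeEntropySUNLaw.lean`, p260440, from the Haar volume of action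
balls `SUN.haarActionBallLower/Upper`).  This file discharges that hypothesis in the six `SU(N)`
theorems of the entropy ⇒ ESS package that were stated "given `SUN.EntropyGrowthLaw d N`"
(`…_of`), so that for every `N ≥ 1` and every `d` — in particular `SU(3)`, `d = 4` — the
VOLUME × COUPLING LAW, the DEPTH LAW (measure-class couplings with Jacobian floor `e^{−ℓ}` on
`≤ V_a` active links per layer) and the NO-GO for Haar-preserving coupling layers hold with NO
open hypothesis:
`(N²−1)((d−1)L^d(1/2 − 1/L) − 1/2)·log β − c·L^d − t ≤ n·ℓ·V_a + log M` whenever the `n`-layer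
sampler reaches `ESS ≥ e^{−t}` against the Wilson measure at coupling `β ≥ 1` from a prior of
density `≤ M`.  Imports `EntropyBudgetHaarMoves` (item 22g, the last of the chain 22d → 22e →
22f → 22g) and the tree's `LatticeEntropySUNLaw` ⇒ lands after 22g.
-/

noncomputable section

namespace Summit.Ventures.LatticeQCDFlow.Theory2.Lattice

open MeasureTheory Summit.Ventures.LatticeQCDFlow.Exactness
open Literature.MathematicalPhysics.QuantumLattice Literature.MathematicalPhysics.QuantumFieldTheory
open scoped ENNReal

/-- **The depth law in architecture form (measure-class coupling layers) for `SU(N)`,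
UNCONDITIONAL** — in particular for `SU(3)`, `d = 4`. [folklore] -/
theorem SUN.depth_lower_bound_coupling (d N : ℕ) (hN : 1 ≤ N) :
    ∃ c : ℝ, ∀ (L : ℕ) [NeZero L], 2 ≤ L → ∀ β : ℝ, 1 ≤ β →
      ∀ (n : ℕ) (P : Fin n → Edge d L → Prop) [∀ k, DecidablePred (P k)]
        (Ψ : (k : Fin n) → {e // P k e} → ({e // ¬P k e} → Matrix.specialUnitaryGroup (Fin N) ℂ) →
          Matrix.specialUnitaryGroup (Fin N) ℂ ≃ᵐ Matrix.specialUnitaryGroup (Fin N) ℂ)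
        (Jf : (k : Fin n) → {e // P k e} → ({e // ¬P k e} → Matrix.specialUnitaryGroup (Fin N) ℂ) →
          Matrix.specialUnitaryGroup (Fin N) ℂ → ℝ)
        (hΨ : ∀ k a, Measurable fun q : Matrix.specialUnitaryGroup (Fin N) ℂ ×
          ({e // ¬P k e} → Matrix.specialUnitaryGroup (Fin N) ℂ) => Ψ k a q.2 q.1)
        (hΨs : ∀ k a, Measurable fun q : Matrix.specialUnitaryGroup (Fin N) ℂ ×
          ({e // ¬P k e} → Matrix.specialUnitaryGroup (Fin N) ℂ) => (Ψ k a q.2).symm q.1)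
        (r : GaugeConfig d L (Matrix.specialUnitaryGroup (Fin N) ℂ) → ℝ) (ℓ Va M t : ℝ),
        (∀ k a, Measurable fun q : Matrix.specialUnitaryGroup (Fin N) ℂ ×
          ({e // ¬P k e} → Matrix.specialUnitaryGroup (Fin N) ℂ) => Jf k a q.2 q.1) →
        (∀ k a y, HasJacobian (haarProbability (Matrix.specialUnitaryGroup (Fin N) ℂ)) (Ψ k a y)
          fun g => ENNReal.ofReal (Jf k a y g)) →
        (∀ k a y g, 0 < Jf k a y g) → (∀ k a y g, (Jf k a y g)⁻¹ ≤ Real.exp ℓ) → 0 ≤ ℓ →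
        (∀ k, (Fintype.card {e // P k e} : ℝ) ≤ Va) →
        Measurable r → (∀ V, 0 < r V) → (∀ V, r V ≤ M) →
          Real.exp (-t) ≤ essM (wilsonMeasure (d := d) (L := L) (fundamentalRep (Fin N)) β)
              (Measure.map (layersEquiv (List.ofFn fun k =>
                  (coupleEquiv (Ψ k) (hΨ k) (hΨs k), coupleJac (P k) (Jf k))))
                ((Measure.pi fun _ : Edge d L =>
                  haarProbability (Matrix.specialUnitaryGroup (Fin N) ℂ)).withDensity
                  fun V => ENNReal.ofReal (r V))) →
            ((N : ℝ) ^ 2 - 1) * (((d : ℝ) - 1) * (L : ℝ) ^ d * (1 / 2 - 1 / L) - 1 / 2) *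
                Real.log β - c * (L : ℝ) ^ d - t ≤ (n : ℝ) * (ℓ * Va) + Real.log M :=
  SUN.depth_lower_bound_coupling_of d N (SUN.entropyGrowthLaw d N) hN

/-- **No-go for Haar-preserving coupling layers on `SU(N)`, UNCONDITIONAL.** [folklore] -/
theorem SUN.no_capacity_of_measurePreserving (d N : ℕ) (hN : 1 ≤ N) :
    ∃ c : ℝ, ∀ (L : ℕ) [NeZero L], 2 ≤ L → ∀ β : ℝ, 1 ≤ β →
      ∀ (n : ℕ) (P : Fin n → Edge d L → Prop) [∀ k, DecidablePred (P k)]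
        (Ψ : (k : Fin n) → {e // P k e} → ({e // ¬P k e} → Matrix.specialUnitaryGroup (Fin N) ℂ) →
          Matrix.specialUnitaryGroup (Fin N) ℂ ≃ᵐ Matrix.specialUnitaryGroup (Fin N) ℂ)
        (hΨ : ∀ k a, Measurable fun q : Matrix.specialUnitaryGroup (Fin N) ℂ ×
          ({e // ¬P k e} → Matrix.specialUnitaryGroup (Fin N) ℂ) => Ψ k a q.2 q.1)
        (hΨs : ∀ k a, Measurable fun q : Matrix.specialUnitaryGroup (Fin N) ℂ ×
          ({e // ¬P k e} → Matrix.specialUnitaryGroup (Fin N) ℂ) => (Ψ k a q.2).symm q.1)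
        (r : GaugeConfig d L (Matrix.specialUnitaryGroup (Fin N) ℂ) → ℝ) (M t : ℝ),
        (∀ k a y, MeasurePreserving (Ψ k a y)
          (haarProbability (Matrix.specialUnitaryGroup (Fin N) ℂ))
          (haarProbability (Matrix.specialUnitaryGroup (Fin N) ℂ))) →
        Measurable r → (∀ V, 0 < r V) → (∀ V, r V ≤ M) →
          Real.exp (-t) ≤ essM (wilsonMeasure (d := d) (L := L) (fundamentalRep (Fin N)) β)
              (Measure.map (layersEquiv (List.ofFn fun k =>
                  (coupleEquiv (Ψ k) (hΨ k) (hΨs k),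
                    coupleJac (P k) fun _ _ _ => (1 : ℝ))))
                ((Measure.pi fun _ : Edge d L =>
                  haarProbability (Matrix.specialUnitaryGroup (Fin N) ℂ)).withDensity
                  fun V => ENNReal.ofReal (r V))) →
            ((N : ℝ) ^ 2 - 1) * (((d : ℝ) - 1) * (L : ℝ) ^ d * (1 / 2 - 1 / L) - 1 / 2) *
                Real.log β - c * (L : ℝ) ^ d - t ≤ Real.log M :=
  SUN.no_capacity_of_measurePreserving_of d N (SUN.entropyGrowthLaw d N) hN

end Summit.Ventures.LatticeQCDFlow.Theory2.Lattice

end
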